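import Mathlib

/-!
# LatticeQCDFlow / Scaling — the sharp cosine budget `Σ (1 - cos xᵢ) ≥ m·(1 - cos(π/m))` when `Σ |xᵢ| ≥ π`

HONEST FRAMING: exact (Metropolis-corrected) sampling algorithms for lattice gauge theory;
figures of merit are autocorrelation/cost numbers at stated couplings and volumes; no
continuum-physics claim.

THEORY-2.md §3.3 (v3.0, theory seat GEN-17).  Pure real analysis used by `Scaling/FluxPatch.lean` to give the
SHARP patch constant of the local-move tunnelling law: if `m ≥ 1` angles `|xᵢ| ≤ π` have `Σ|xᵢ| ≥ π` then
`Σ(1 - cos xᵢ) ≥ m(1 - cos(π/m))` (equality at `|xᵢ| = π/m`; `= 2` for `m ≤ 2`, `∼ π²/2m` for large `m`).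
Proof: for `m ≥ 3`, either every `|xᵢ| ≤ π - π/m` and the tangent line of `cos` at `π/m` lies above `cos` on
`[0, π - π/m]` (`cos_le_cos_sub_sin_mul`, by monotonicity of `cos c - sin c (y - c) - cos y`), or one term alone
gives `1 - cos xⱼ ≥ 1 + cos(π/m) ≥ m(1 - cos(π/m))` (`cos(π/3) = 1/2`; `1 - c²/2 ≤ cos c` for `m ≥ 4`); the cases
`m = 1, 2` are direct.  No sorry; Mathlib only.
-/

noncomputable section

namespace Summit.Ventures.LatticeQCDFlow.Theory2.Trig

open Real Set


/-- Tangent-line bound for the cosine at `c ∈ [0, π/2]` on `[0, π - c]`: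
`cos x ≤ cos c - sin c·(x - c)`. [folklore] -/
theorem cos_le_cos_sub_sin_mul {c x : ℝ} (hc0 : 0 ≤ c) (hc : c ≤ π / 2) (hx0 : 0 ≤ x)
    (hx : x ≤ π - c) : Real.cos x ≤ Real.cos c - Real.sin c * (x - c) := by
  have hd : ∀ y, HasDerivAt (fun y : ℝ => Real.cos c - Real.sin c * (y - c) - Real.cos y)
      (Real.sin y - Real.sin c) y := by
    intro y
    have h2 : HasDerivAt (fun y : ℝ => Real.cos c - Real.sin c * (y - c) - Real.cos y)
        (0 - Real.sin c * 1 - -Real.sin y) y :=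
      ((hasDerivAt_const y (Real.cos c)).sub
        (((hasDerivAt_id' y).sub_const c).const_mul (Real.sin c))).sub (Real.hasDerivAt_cos y)
    have e : (0 : ℝ) - Real.sin c * 1 - -Real.sin y = Real.sin y - Real.sin c := by ring
    rw [e] at h2
    exact h2
  have hcont : Continuous (fun y : ℝ => Real.cos c - Real.sin c * (y - c) - Real.cos y) := by
    fun_prop
  have hval : (fun y : ℝ => Real.cos c - Real.sin c * (y - c) - Real.cos y) c = 0 := by simp
  suffices h0 : 0 ≤ (fun y : ℝ => Real.cos c - Real.sin c * (y - c) - Real.cos y) x by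
    simp only at h0; linarith
  rcases le_total c x with hcx | hxc
  · have hmono : MonotoneOn (fun y : ℝ => Real.cos c - Real.sin c * (y - c) - Real.cos y)
        (Icc c (π - c)) := by
      refine monotoneOn_of_deriv_nonneg (convex_Icc _ _) hcont.continuousOn
        (fun y _ => (hd y).differentiableAt.differentiableWithinAt) fun y hy => ?_
      rw [interior_Icc] at hy
      rw [(hd y).deriv, sub_nonneg]
      rcases le_or_gt y (π / 2) with hy2 | hy2
      · exact Real.sin_le_sin_of_le_of_le_pi_div_two (by linarith) hy2 hy.1.le
      · rw [← Real.sin_pi_sub y]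
        exact Real.sin_le_sin_of_le_of_le_pi_div_two (by linarith) (by linarith) (by linarith [hy.2])
    have := hmono ⟨le_rfl, by linarith⟩ ⟨hcx, hx⟩ hcx
    rwa [hval] at this
  · have hanti : AntitoneOn (fun y : ℝ => Real.cos c - Real.sin c * (y - c) - Real.cos y)
        (Icc 0 c) := by
      refine antitoneOn_of_deriv_nonpos (convex_Icc _ _) hcont.continuousOn
        (fun y _ => (hd y).differentiableAt.differentiableWithinAt) fun y hy => ?_
      rw [interior_Icc] at hy
      rw [(hd y).deriv, sub_nonpos]
      exact Real.sin_le_sin_of_le_of_le_pi_div_two (by linarith [hy.1]) hc hy.2.le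
    have := hanti ⟨hx0, hxc⟩ ⟨hc0, le_rfl⟩ hxc
    rwa [hval] at this

/-- **Sharp cosine budget.**  If `|x_i| ≤ π` and `Σ_{i ∈ s} |x_i| ≥ π` over a non-empty finite set
of `m` indices, then `Σ_{i ∈ s} (1 - cos x_i) ≥ m·(1 - cos(π/m))` — equality at `|x_i| = π/m`; the
cases `m = 1, 2` are `2`, the case `m ≥ 3` is the tangent line at `π/m` plus one large term.
[folklore] -/
theorem card_mul_one_sub_cos_le_sum {ι : Type*} (s : Finset ι) (x : ι → ℝ) (hs : s.Nonempty)
    (hxπ : ∀ i ∈ s, |x i| ≤ π) (hsum : π ≤ ∑ i ∈ s, |x i|) :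
    (s.card : ℝ) * (1 - Real.cos (π / s.card)) ≤ ∑ i ∈ s, (1 - Real.cos (x i)) := by
  classical
  have hcos : ∀ i, Real.cos (x i) = Real.cos |x i| := fun i => (Real.cos_abs (x i)).symm
  simp_rw [hcos]
  have hm1 : 1 ≤ s.card := hs.card_pos
  obtain h1 | h2 | h3 : s.card = 1 ∨ s.card = 2 ∨ 3 ≤ s.card := by omega
  · obtain ⟨i, hi⟩ := Finset.card_eq_one.mp h1
    rw [h1, hi, Finset.sum_singleton]
    rw [hi, Finset.sum_singleton] at hsum
    have hxi : |x i| = π :=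
      le_antisymm (hxπ i (by rw [hi]; exact Finset.mem_singleton_self i)) hsum
    rw [hxi, Nat.cast_one, div_one, Real.cos_pi]
    norm_num
  · obtain ⟨a, b, hab, hs2⟩ := Finset.card_eq_two.mp h2
    rw [h2, hs2, Finset.sum_pair hab]
    rw [hs2, Finset.sum_pair hab] at hsum
    have ha := hxπ a (by rw [hs2]; simp)
    have hb := hxπ b (by rw [hs2]; simp)
    have hcos2 : Real.cos |x b| ≤ Real.cos (π - |x a|) :=
      Real.cos_le_cos_of_nonneg_of_le_pi (by linarith) hb (by linarith)
    rw [Real.cos_pi_sub] at hcos2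
    have e2 : Real.cos (π / ((2 : ℕ) : ℝ)) = 0 := by rw [Nat.cast_ofNat, Real.cos_pi_div_two]
    rw [e2]
    push_cast
    linarith
  · have hmpos : (0 : ℝ) < s.card := by exact_mod_cast (by omega : 0 < s.card)
    have hm3r : (3 : ℝ) ≤ s.card := by exact_mod_cast h3
    set c := π / (s.card : ℝ) with hc_def
    have hc0 : 0 < c := div_pos Real.pi_pos hmpos
    have hmc : (s.card : ℝ) * c = π := by rw [hc_def]; field_simp
    have hcle : c ≤ π / 3 := by
      rw [hc_def]; exact div_le_div_of_nonneg_left Real.pi_pos.le (by norm_num) hm3r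
    have hc2 : c ≤ π / 2 := hcle.trans (by linarith [Real.pi_pos])
    have hsin : 0 ≤ Real.sin c := Real.sin_nonneg_of_nonneg_of_le_pi hc0.le (by linarith [Real.pi_pos])
    have hnonneg : ∀ i ∈ s, 0 ≤ 1 - Real.cos |x i| := fun i _ => by
      linarith [Real.cos_le_one |x i|]
    by_cases hA : ∀ i ∈ s, |x i| ≤ π - c
    · have e1 : ∑ i ∈ s, ((1 - Real.cos c) + Real.sin c * (|x i| - c)) =
          (s.card : ℝ) * (1 - Real.cos c) + Real.sin c * ∑ i ∈ s, |x i| -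
            Real.sin c * ((s.card : ℝ) * c) := by
        rw [Finset.sum_add_distrib, Finset.sum_const, nsmul_eq_mul, ← Finset.mul_sum,
          Finset.sum_sub_distrib, Finset.sum_const, nsmul_eq_mul]
        ring
      have hle : ∑ i ∈ s, ((1 - Real.cos c) + Real.sin c * (|x i| - c)) ≤
          ∑ i ∈ s, (1 - Real.cos |x i|) :=
        Finset.sum_le_sum fun i hi => by
          linarith [cos_le_cos_sub_sin_mul hc0.le hc2 (abs_nonneg (x i)) (hA i hi)]
      have hextra : 0 ≤ Real.sin c * (∑ i ∈ s, |x i| - π) := mul_nonneg hsin (by linarith)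
      rw [hmc] at e1
      nlinarith [e1, hle, hextra]
    · push Not at hA
      obtain ⟨j, hj, hjc⟩ := hA
      have hcosj : Real.cos |x j| ≤ Real.cos (π - c) :=
        Real.cos_le_cos_of_nonneg_of_le_pi (by linarith [Real.pi_pos]) (hxπ j hj) hjc.le
      rw [Real.cos_pi_sub] at hcosj
      have hjle : 1 - Real.cos |x j| ≤ ∑ i ∈ s, (1 - Real.cos |x i|) :=
        Finset.single_le_sum hnonneg hj
      have hkey : (s.card : ℝ) * (1 - Real.cos c) ≤ 1 + Real.cos c := by
        rcases h3.eq_or_lt with h3e | h4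
        · have hm3e : (s.card : ℝ) = 3 := by exact_mod_cast h3e.symm
          have hc3 : c = π / 3 := by rw [hc_def, hm3e]
          rw [hm3e, hc3, Real.cos_pi_div_three]
          norm_num
        · have hm4 : (4 : ℝ) ≤ s.card := by exact_mod_cast h4
          have ht : 1 - c ^ 2 / 2 ≤ Real.cos c := Real.one_sub_sq_div_two_le_cos
          have hπ2 : π ^ 2 < 9.9225 := by nlinarith [Real.pi_lt_d2, Real.pi_pos]
          have hc2m : (s.card : ℝ) ^ 2 * c ^ 2 = π ^ 2 := by rw [← mul_pow, hmc]
          have h4c : ((s.card : ℝ) + 1) * c ^ 2 ≤ 4 := by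
            have hpoly : ((s.card : ℝ) + 1) * 9.9225 ≤ 4 * (s.card : ℝ) ^ 2 := by
              nlinarith [mul_nonneg (sub_nonneg.2 hm4)
                (by positivity : (0 : ℝ) ≤ 4 * s.card + 6.0775)]
            have hm2 : (0 : ℝ) < (s.card : ℝ) ^ 2 := by positivity
            have key : ((s.card : ℝ) + 1) * c ^ 2 * (s.card : ℝ) ^ 2 ≤ 4 * (s.card : ℝ) ^ 2 :=
              calc ((s.card : ℝ) + 1) * c ^ 2 * (s.card : ℝ) ^ 2
                  = ((s.card : ℝ) + 1) * π ^ 2 := by rw [← hc2m]; ring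
                _ ≤ ((s.card : ℝ) + 1) * 9.9225 :=
                    mul_le_mul_of_nonneg_left hπ2.le (by positivity)
                _ ≤ 4 * (s.card : ℝ) ^ 2 := hpoly
            exact le_of_mul_le_mul_right key hm2
          have hmt : ((s.card : ℝ) + 1) * (1 - c ^ 2 / 2) ≤ ((s.card : ℝ) + 1) * Real.cos c :=
            mul_le_mul_of_nonneg_left ht (by positivity)
          nlinarith [hmt, h4c]
      linarith [hkey, hcosj, hjle]


end Summit.Ventures.LatticeQCDFlow.Theory2.Trig
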